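/-
Origin: expansion seat `prover-pub-hodgecm-mc-binder-1-g13-0`, handover #66 2026-08-20T13:44:28Z md5 c6aca8e310c5 (NEW additive KERNEL leaf; imports #54 + #65 + Model/ArchConjLeviVT + Model/ArchLineDatumOf; drops ⇒ {#67,#68}) (`HOME/mc/pub-hodgecm-mc-binder-1-g13/stage52/HodgeCM/Model/Binders/Real34Harch.lean`, md5 c6aca8e310c5, 335 lines);
landed by the second packager p2 gen 8 (p2-g8) in gate run 52 as `HodgeCM/Model/Binders/Real34Harch.lean` (verbatim).
-/
/-
Origin: speedrun cell pub-hodgecm, MODEL-CONSTRUCTION sub-cell, unit pub-hodgecm-mc-binder-1-g13 (BINDER PROVER, gen 13; row 17 `real34`: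
the archimedean letter identity `harch` of the socket `Real34CensusSideT.ofCensus` (#56), ASSEMBLED modulo one polynomial identity), seat
prover-pub-hodgecm-mc-binder-1-g13-0, 2026-08-20.  Target in PKG: HodgeCM/Model/Binders/Real34Harch.lean (NEW additive leaf; imports
binder-1 #54 `Binders/Real34ConcreteIns` (`archVec₃₄`), binder-1 `Binders/Real34TwistTransport` (`isoTwistPin = conjTransportK`),
sinst-1 #1225 `Model/ArchConjLeviVT` ((VT)), hence period-1 #P48a `Model/ArchConjSlotStrip` ((STRIP)) and theta-3 (K9)
`Model/ArchConjFrameTransport`; carch-1 `Model/ArchLineDatumOf` (the line letters as Folland–Fock vectors)).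
KERNEL ONLY: 3 reducible abbreviations (names for carch-1's line family, its place polynomial, the wedge polynomial) + theorems; 0 records,
nothing cited, 0 `def … : Prop`; MODEL-N ±0; E unchanged.  Nothing here is a claim of the manuscripts under adjudication.
-/
import Summits.HodgeConjecture.HodgeCM.Model.Binders.Real34ConcreteIns
import Summits.HodgeConjecture.HodgeCM.Model.Binders.Real34TwistTransport
import Summits.HodgeConjecture.HodgeCM.Model.ArchConjLeviVT
import Summits.HodgeConjecture.HodgeCM.Model.ArchLineDatumOf_3

/-!
# Row 17's archimedean letter identity `harch`, assembled from (STRIP) + (VT) + the frame transport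

`Real34CensusSideT.ofCensus` (#56) takes, per good sextic context, the hypothesis

  `harch : ∃ Tinf Tf, (∀ Φ₂ Φ₃ F₂ F₃, tau34 (E₃(Φ₂ ⊗ F₂)) (E₃(Φ₃ ⊗ F₃)) = E₆ (Tinf Φ₂ Φ₃ ⊗ Tf F₂ F₃)) ∧ span (range ↿Tf) = ⊤ ∧
      ∃ a, archVec₃₄ … φ₀ = a • (Tinf (Z₂ e₀^∨) (Z₃ e₁^∨) − Tinf (Z₂ e₁^∨) (Z₃ e₀^∨))`

at carch-1's vacuum line families `Z₂, Z₃` (#CA56).  This leaf proves it from ONE polynomial identity `hpoly` (§ 3), everything else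
being kernel theorems already in the package:

* § 1 `(T1)`/`(T2)`: period-1's (STRIP) `ArchConjSlotStrip.exists_cmConjLineTensorFin_tmul_eq_tmul` gives `tau34 = cmConjLineTensorFin …`
  the pure-tensor shape with `Tinf Φ₀ Φ₁ = R_e (A_∞ (conjSlotRawBox Φ₀ Φ₁))`, `Tf f₀ f₁ = R_e^f (M_f (conjSlotRawFin f₀ f₁))`
  (`A_∞`, `M_f` automorphisms); `span_range_conjSlotTf_eq_top` is #55's spanning argument for this `Tf`;
* § 2 the line letters: `lineFam V S k hpos` NAMES carch-1's family (an `abbrev` of the #CA56 literal), `lineFam_proj` reads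
  `Z_k e_a^∨` as the Folland–Fock vector `follandFock (lineFrameOf V (dW′ S) k) (linePoly …)` (carch-1's
  `blockFamilyOfAt_degOnePDual_binvPi_one`), (K9) `slotArchBox_follandFock_of` turns the letter wedge into ONE Folland–Fock vector
  `follandFock (planeFrame V (dW′ S)) (wedgePoly …)` of the primed plane, and (K9) `follandFock_planeFrame_dW'_conjFrameTransport`
  carries it along `J_S` to `follandFock (slotFrame V S) (rename (conjColPerm S) (wedgePoly …))`;
* § 3 **`harch_of_insPoly`**: sinst-1's (VT) `exists_reindex_archFactor_eq_smul_cmArchWeilRep_cmConjSeesawMp` (`R_e ∘ A_∞ = c • ω_∞(1, k) ∘ (· ∘ J_S) ∘ R_e`,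
  `k = conjTransportK S`), binder-1's `isoTwistPin_eq_conjTransportK` (`archVec₃₄ φ = η(…) • ω_∞(1, k) (follandFock slotFrame (insPoly φ))`)
  and `hpoly : insPoly … φ = a″ • rename (conjColPerm S) (wedgePoly …)` give `harch` with `a := η(…) · a″ · c⁻¹` (`c ≠ 0` since `A_∞`
  is bijective and `follandFock slotFrame 1 ≠ 0`).

What is left for row 17's `harch` after this leaf: the identity `hpoly` for the BASE letter `φ₀` of binder-2's printed places (det at `ι₁`,
`1` elsewhere — `OmgInsVacuum.placePoly_vacuum`) against the wedge of carch-1's degree-one letters at `v₁` (`linePlacePoly_same/_of_ne`):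
pure index bookkeeping in `MvPolynomial (Fin (3·2) × realplaces) ℂ`.
-/

set_option autoImplicit false

noncomputable section

open MeasureTheory NumberField MulAction IsDedekindDomain
open scoped NumberField
open scoped Matrix Kronecker InnerProductSpace TensorProduct Classical SchwartzMap

attribute [-instance] Quotient.instMeasurableSpace

namespace HodgeCM.Model

open MvPolynomial (rename)
open NumberField.InfinitePlace NumberField.mixedEmbedding
open Literature.NumberTheory.Weil1964 Literature.NumberTheory.Automorphic Literature.NumberTheory.Automorphic.UnitaryGroup
open Literature.RepresentationTheory.HeisenbergGroup
open Literature.RepresentationTheory.KonnoKonno2007 Literature.RepresentationTheory.KonnoKonno2007.RealDualPair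
open Literature.NumberTheory.GelbartRogawski1991 Literature.NumberTheory.GelbartRogawski1991.UnitaryDualPair
open Literature.RepresentationTheory (atPlace)
open Literature.Analysis.SegalBargmann
open HodgeCM HodgeCM.Adelic HodgeCM.PerL34 HodgeCM.Model.HypCensus HodgeCM.Model.ArchSideTerm HodgeCM.Model.ArchLevi
open HodgeCM.PerL34.Fock HodgeCM.PerL34.Fock.PrintDict

/-! ## 1. `(T1)`/`(T2)`: the reindexed see-saw composite for a GIVEN stripping `(A_∞, M_f)` -/

section Generic

variable {F : Type} [Field F] [NumberField F]

/-- **#55's `exists_reindex_omega_tensorToSum_tmul` with the archimedean factor EXPOSED.**  For `q ∈ Mp_ψ(W_𝔸)ᶜᵒⁿᵗ` over `κ` with a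
pure-tensor decomposition `ω(q) (Φ ⊗ f) = A Φ ⊗ M_f f` (`M_f` a linear equivalence) and reindexings `e : κ ≃ κ₁ ⊕ κ₂`, `eW : κ ≃ ιW`,
`e_j : κ_j ≃ ι_j`: the composite `(φ₁, φ₂) ↦ R_{eW} (ω(q) (R_e⁻¹ (R_{e₁}⁻¹ φ₁ ⊠ R_{e₂}⁻¹ φ₂)))` sends `(E(Φ₁ ⊗ f₁), E(Φ₂ ⊗ f₂))` to
`E (Tinf Φ₁ Φ₂ ⊗ Tf f₁ f₂)` with the EXPLICIT `Tinf Φ₁ Φ₂ = R_{eW} (A (R_e⁻¹ (R_{e₁}⁻¹ Φ₁ ⊠ R_{e₂}⁻¹ Φ₂)))` and some bilinear `Tf` whose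
values span. -/
theorem exists_Tf_reindex_omega_tensorToSum_tmul {κ₁ κ₂ κ ι₁ ι₂ ιW : Type} [Fintype κ₁] [Fintype κ₂] [Fintype κ] [Fintype ι₁]
    [Fintype ι₂] [Fintype ιW] [DecidableEq κ] (e : κ ≃ κ₁ ⊕ κ₂) (eW : κ ≃ ιW) (e₁ : κ₁ ≃ ι₁) (e₂ : κ₂ ≃ ι₂)
    {T : Matrix κ κ (AdeleRing (𝓞 F) F)} (q : adelicMpCont F κ T)
    (A : SchwartzMap (κ → mixedSpace F) ℂ →L[ℂ] SchwartzMap (κ → mixedSpace F) ℂ) (Mf : FinSB F κ ≃ₗ[ℂ] FinSB F κ)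
    (hAM : ∀ (Φ : SchwartzMap (κ → mixedSpace F) ℂ) (f : FinSB F κ),
      adelicMpCont.omega F κ T q (piSchwartzBruhatEquiv F κ (Φ ⊗ₜ f)) = piSchwartzBruhatEquiv F κ (A Φ ⊗ₜ Mf f)) :
    ∃ (Tf : FinSB F ι₁ →ₗ[ℂ] FinSB F ι₂ →ₗ[ℂ] FinSB F ιW),
      (∀ (Φ₁ : SchwartzMap (ι₁ → mixedSpace F) ℂ) (Φ₂ : SchwartzMap (ι₂ → mixedSpace F) ℂ) (f₁ : FinSB F ι₁) (f₂ : FinSB F ι₂),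
        piSBReindex F eW (adelicMpCont.omega F κ T q ((piSBReindex F e).symm
          (tensorToSum F κ₁ κ₂ ((piSBReindex F e₁).symm (piSchwartzBruhatEquiv F ι₁ (Φ₁ ⊗ₜ f₁)))
            ((piSBReindex F e₂).symm (piSchwartzBruhatEquiv F ι₂ (Φ₂ ⊗ₜ f₂)))))) =
          piSchwartzBruhatEquiv F ιW
            (schwartzReindexCLM F eW (A (schwartzReindexCLM F e.symm
              (archBoxTensor (schwartzReindexCLM F e₁.symm Φ₁) (schwartzReindexCLM F e₂.symm Φ₂)))) ⊗ₜ Tf f₁ f₂)) ∧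
      Submodule.span ℂ (Set.range fun p : FinSB F ι₁ × FinSB F ι₂ => Tf p.1 p.2) = ⊤ := by
  -- the finite part: a linear equivalence after `(f₁, f₂) ↦ R f₁ ⊗ R f₂`
  let Lf : FinSB F κ₁ ⊗[ℂ] FinSB F κ₂ ≃ₗ[ℂ] FinSB F ιW :=
    (finSumEquiv F κ₁ κ₂).trans ((finSBReindex F e.symm).trans (Mf.trans (finSBReindex F eW)))
  let Tf : FinSB F ι₁ →ₗ[ℂ] FinSB F ι₂ →ₗ[ℂ] FinSB F ιW :=
    (TensorProduct.mk ℂ (FinSB F κ₁) (FinSB F κ₂)).compl₁₂ (finSBReindex F e₁.symm : FinSB F ι₁ →ₗ[ℂ] FinSB F κ₁)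
      (finSBReindex F e₂.symm : FinSB F ι₂ →ₗ[ℂ] FinSB F κ₂) |>.compr₂ (Lf : FinSB F κ₁ ⊗[ℂ] FinSB F κ₂ →ₗ[ℂ] FinSB F ιW)
  refine ⟨Tf, fun Φ₁ Φ₂ f₁ f₂ => ?_, ?_⟩
  · have h1 : (piSBReindex F e₁).symm (piSchwartzBruhatEquiv F ι₁ (Φ₁ ⊗ₜ f₁)) =
        piSchwartzBruhatEquiv F κ₁ (schwartzReindexCLM F e₁.symm Φ₁ ⊗ₜ finSBReindex F e₁.symm f₁) :=
      piSBReindex_tmul F e₁.symm Φ₁ f₁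
    have h2 : (piSBReindex F e₂).symm (piSchwartzBruhatEquiv F ι₂ (Φ₂ ⊗ₜ f₂)) =
        piSchwartzBruhatEquiv F κ₂ (schwartzReindexCLM F e₂.symm Φ₂ ⊗ₜ finSBReindex F e₂.symm f₂) :=
      piSBReindex_tmul F e₂.symm Φ₂ f₂
    have h3 := tensorToSum_tmul (K := F) (schwartzReindexCLM F e₁.symm Φ₁) (finSBReindex F e₁.symm f₁)
      (schwartzReindexCLM F e₂.symm Φ₂) (finSBReindex F e₂.symm f₂)
    have inner : tensorToSum F κ₁ κ₂ ((piSBReindex F e₁).symm (piSchwartzBruhatEquiv F ι₁ (Φ₁ ⊗ₜ f₁)))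
        ((piSBReindex F e₂).symm (piSchwartzBruhatEquiv F ι₂ (Φ₂ ⊗ₜ f₂))) =
        piSchwartzBruhatEquiv F (κ₁ ⊕ κ₂) (archBoxTensor (schwartzReindexCLM F e₁.symm Φ₁) (schwartzReindexCLM F e₂.symm Φ₂) ⊗ₜ
          finSumEquiv F κ₁ κ₂ (finSBReindex F e₁.symm f₁ ⊗ₜ finSBReindex F e₂.symm f₂)) := by
      rw [h1, h2]; exact h3
    have h4 : (piSBReindex F e).symm (piSchwartzBruhatEquiv F (κ₁ ⊕ κ₂)
        (archBoxTensor (schwartzReindexCLM F e₁.symm Φ₁) (schwartzReindexCLM F e₂.symm Φ₂) ⊗ₜ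
          finSumEquiv F κ₁ κ₂ (finSBReindex F e₁.symm f₁ ⊗ₜ finSBReindex F e₂.symm f₂))) = _ :=
      piSBReindex_tmul F e.symm (archBoxTensor (schwartzReindexCLM F e₁.symm Φ₁) (schwartzReindexCLM F e₂.symm Φ₂))
        (finSumEquiv F κ₁ κ₂ (finSBReindex F e₁.symm f₁ ⊗ₜ finSBReindex F e₂.symm f₂))
    have h5 := hAM (schwartzReindexCLM F e.symm (archBoxTensor (schwartzReindexCLM F e₁.symm Φ₁) (schwartzReindexCLM F e₂.symm Φ₂)))
      (finSBReindex F e.symm (finSumEquiv F κ₁ κ₂ (finSBReindex F e₁.symm f₁ ⊗ₜ finSBReindex F e₂.symm f₂)))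
    have h6 := piSBReindex_tmul F eW
      (A (schwartzReindexCLM F e.symm (archBoxTensor (schwartzReindexCLM F e₁.symm Φ₁) (schwartzReindexCLM F e₂.symm Φ₂))))
      (Mf (finSBReindex F e.symm (finSumEquiv F κ₁ κ₂ (finSBReindex F e₁.symm f₁ ⊗ₜ finSBReindex F e₂.symm f₂))))
    exact (congrArg (fun x => piSBReindex F eW (adelicMpCont.omega F κ T q ((piSBReindex F e).symm x))) inner).trans
      ((congrArg (fun y => piSBReindex F eW (adelicMpCont.omega F κ T q y)) h4).trans
        ((congrArg (piSBReindex F eW) h5).trans h6))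
  · rw [eq_top_iff]
    rintro G -
    have hG : Lf.symm G ∈ Submodule.span ℂ {t : FinSB F κ₁ ⊗[ℂ] FinSB F κ₂ | ∃ a b, a ⊗ₜ b = t} := by
      rw [TensorProduct.span_tmul_eq_top]; exact Submodule.mem_top
    have himg := Submodule.mem_map_of_mem (f := (Lf : FinSB F κ₁ ⊗[ℂ] FinSB F κ₂ →ₗ[ℂ] FinSB F ιW)) hG
    rw [LinearEquiv.coe_coe, LinearEquiv.apply_symm_apply, Submodule.map_span] at himg
    refine Submodule.span_mono ?_ himg
    rintro _ ⟨t, ⟨a, b, rfl⟩, rfl⟩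
    refine ⟨(finSBReindex F e₁ a, finSBReindex F e₂ b), ?_⟩
    change Lf (finSBReindex F e₁.symm (finSBReindex F e₁ a) ⊗ₜ finSBReindex F e₂.symm (finSBReindex F e₂ b)) = Lf (a ⊗ₜ b)
    congr 2
    · exact (finSBReindex F e₁).symm_apply_apply a
    · exact (finSBReindex F e₂).symm_apply_apply b

end Generic

/-! ## 2. carch-1's line letters as Folland–Fock vectors, their wedge, and its transport along `J_S` -/

section Letters

variable {L : CMField} {ι₁ : L →+* ℂ} (V : HermSpace3 L ι₁) (S : StubTree.SeesawDatum L)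

/-- **carch-1's vacuum line family of the line `⟨dW′ S k⟩`** (#CA56's `Z₂`/`Z₃` literal, `k = 0, 1`): `Φ₁ = degOnePDual Empty`, `Φ₂ = B⁻¹ 1`. -/
abbrev lineFam (k : Fin 2)
    (hpos : 0 < cmXW (L : Type) (frameD V) (lineVec (L : Type) (dW' S k)) (fun _ => dW'_real S k) ι₁ (HypCensus.cmPlace (L : Type) ι₁) 0) :
    Module.Dual ℂ (Fin 2 → ℂ) →ₗ[ℂ] 𝓢((Fin 3 → mixedSpace (↥(maximalRealSubfield (L : Type)))), ℂ) :=
  blockFamilyOfAt (L : Type) e₁ (frameD V) (frameD_real V) (frameD_ne V) (lineVec (L : Type) (dW' S k)) (fun _ => dW'_real S k)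
    (fun _ => dW'_ne S k) ι₁ (blockPosEquiv V) (blockNegEquiv V) (posIdxEquivUnit hpos) (negIdxEquivEmpty hpos) (degOnePDual Empty) (binvPi 1)

/-- the place polynomial product of the degree-one letter `e_a^∨` of the line `⟨dW′ S k⟩` (carch-1's `linePlacePoly` at `b = e_a`). -/
abbrev linePoly (k : Fin 2)
    (hpos : 0 < cmXW (L : Type) (frameD V) (lineVec (L : Type) (dW' S k)) (fun _ => dW'_real S k) ι₁ (HypCensus.cmPlace (L : Type) ι₁) 0)
    (a : Fin 2) : MvPolynomial (Fin 3 × {v : InfinitePlace (↥(maximalRealSubfield (L : Type))) // v.IsReal}) ℂ :=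
  ∏ w, rename (atPlace w) (linePlacePoly Empty (L : Type) e₁ (frameD V) (frameD_real V) (lineVec (L : Type) (dW' S k)) (fun _ => dW'_real S k) ι₁
    (blockPosEquiv V) (blockNegEquiv V) (posIdxEquivUnit hpos) (negIdxEquivEmpty hpos) (Pi.single a 1) w)

variable
  (hpos₂ : 0 < cmXW (L : Type) (frameD V) (lineVec (L : Type) (dW' S 0)) (fun _ => dW'_real S 0) ι₁ (HypCensus.cmPlace (L : Type) ι₁) 0)
  (hpos₃ : 0 < cmXW (L : Type) (frameD V) (lineVec (L : Type) (dW' S 1)) (fun _ => dW'_real S 1) ι₁ (HypCensus.cmPlace (L : Type) ι₁) 0)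

/-- **the wedge polynomial** of the two lines in the primed plane frame: `ℓ₂(e₀) ⊠ ℓ₃(e₁) − ℓ₂(e₁) ⊠ ℓ₃(e₀)` through (K9)'s `slotIdx`. -/
abbrev wedgePoly : MvPolynomial (Fin (3 * 2) × {v : InfinitePlace (↥(maximalRealSubfield (L : Type))) // v.IsReal}) ℂ :=
  rename (slotIdx _) (rename Sum.inl (linePoly V S 0 hpos₂ 0) * rename Sum.inr (linePoly V S 1 hpos₃ 1)) -
    rename (slotIdx _) (rename Sum.inl (linePoly V S 0 hpos₂ 1) * rename Sum.inr (linePoly V S 1 hpos₃ 0))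

/-- `e_a^∨ = ⟨e_a, ·⟩`: the coordinate projection is the dot product against `Pi.single a 1`. -/
theorem proj_eq_dotProductEquiv_single (a : Fin 2) :
    (LinearMap.proj a : Module.Dual ℂ (Fin 2 → ℂ)) = dotProductEquiv ℂ (Fin 2) (Pi.single a 1) := by
  ext v
  simp only [LinearMap.coe_comp, LinearMap.coe_proj, Function.comp_apply, Function.eval, LinearMap.coe_single,
    dotProductEquiv_apply_apply, single_dotProduct, one_mul]

/-- **the line letter as a Folland–Fock vector**: `Z_k e_a^∨ = follandFock (lineFrameOf V (dW′ S) k) (linePoly k a)` (carch-1's bridge). -/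
theorem lineFam_proj (k : Fin 2)
    (hpos : 0 < cmXW (L : Type) (frameD V) (lineVec (L : Type) (dW' S k)) (fun _ => dW'_real S k) ι₁ (HypCensus.cmPlace (L : Type) ι₁) 0)
    (a : Fin 2) :
    lineFam V S k hpos (LinearMap.proj a) = follandFock (lineFrameOf V (dW' S) (dW'_real S) (dW'_ne S) k) (linePoly V S k hpos a) := by
  rw [proj_eq_dotProductEquiv_single]
  exact blockFamilyOfAt_degOnePDual_binvPi_one Empty (L : Type) e₁ (frameD V) (frameD_real V) (frameD_ne V) (lineVec (L : Type) (dW' S k))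
    (fun _ => dW'_real S k) (fun _ => dW'_ne S k) ι₁ (blockPosEquiv V) (blockNegEquiv V) (posIdxEquivUnit hpos) (negIdxEquivEmpty hpos)
    (Pi.single a 1)

/-- **the letter wedge is ONE Folland–Fock vector of the primed plane**:
`Z₂e₀ ⊠ Z₃e₁ − Z₂e₁ ⊠ Z₃e₀ = follandFock (planeFrame V (dW′ S)) wedgePoly` (read through `slotArchBox`). -/
theorem slotArchBox_lineFam_wedge :
    slotArchBox (lineFam V S 0 hpos₂ (LinearMap.proj 0)) (lineFam V S 1 hpos₃ (LinearMap.proj 1)) -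
        slotArchBox (lineFam V S 0 hpos₂ (LinearMap.proj 1)) (lineFam V S 1 hpos₃ (LinearMap.proj 0)) =
      follandFock (planeFrame V (dW' S) (dW'_real S) (dW'_ne S)) (wedgePoly V S hpos₂ hpos₃) := by
  rw [lineFam_proj, lineFam_proj, lineFam_proj, lineFam_proj, slotArchBox_follandFock_of, slotArchBox_follandFock_of, wedgePoly,
    ← follandFockₗ_apply, ← follandFockₗ_apply, ← follandFockₗ_apply, map_sub]

/-- **transport along `J_S`**: `(follandFock (planeFrame dW′) Q) ∘ J_S = follandFock (slotFrame V S) (rename (conjColPerm S) Q)` as Schwartz maps. -/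
theorem compCLM_conjFrameTransport_follandFock_planeFrame_dW'
    (Q : MvPolynomial (Fin (3 * 2) × {v : InfinitePlace (↥(maximalRealSubfield (L : Type))) // v.IsReal}) ℂ) :
    SchwartzMap.compCLMOfContinuousLinearEquiv ℂ (conjFrameTransport V S) (follandFock (planeFrame V (dW' S) (dW'_real S) (dW'_ne S)) Q) =
      follandFock (slotFrame V S) (rename (conjColPerm S) Q) := by
  ext y
  rw [SchwartzMap.compCLMOfContinuousLinearEquiv_apply, Function.comp_apply, follandFock_planeFrame_dW'_conjFrameTransport]

end Letters

/-! ## 3. `harch` from ONE polynomial identity -/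

section Harch

variable {L : CMField} {ι₁ : L →+* ℂ} (V : HermSpace3 L ι₁) (S : StubTree.SeesawDatum L)
variable
  (hGR : (cmSplittingDatum (L : Type) finProdFinEquiv (frameD V) (frameD_real V) (frameD_ne V) (dW S) (dW_real S) (dW_ne S)).CompatibleSplitting)
  (η : CMAdelic (L : Type) (frameD V) × CMAdelic (L : Type) (dW S) →* ℂˣ)
variable (datum : ∀ b : InfinitePlace (L : Type),
  PlaceDatum (L : Type) (frameD V) (frameD_real V) (dW S) (dW_real S) ι₁ (cmPlacesEquiv (L : Type) b))
variable (m₁ m₂ : InfinitePlace (L : Type) → ℤ)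
variable
  (hpos₂ : 0 < cmXW (L : Type) (frameD V) (lineVec (L : Type) (dW' S 0)) (fun _ => dW'_real S 0) ι₁ (HypCensus.cmPlace (L : Type) ι₁) 0)
  (hpos₃ : 0 < cmXW (L : Type) (frameD V) (lineVec (L : Type) (dW' S 1)) (fun _ => dW'_real S 1) ι₁ (HypCensus.cmPlace (L : Type) ι₁) 0)

/-- the Gaussian of a frame is not zero. -/
theorem follandFock_frame_one_ne_zero {σ : Type} [Fintype σ] {D : Type*} [NormedAddCommGroup D] [NormedSpace ℝ D] (e : D ≃L[ℝ] (σ → ℝ)) :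
    follandFock e (1 : MvPolynomial σ ℂ) ≠ 0 := fun h =>
  binvPi_one_ne_zero (σ := σ) (((schwartzTransport e).symm.injective (h.trans (map_zero _).symm)))

/-- `R_e (R_e⁻¹ Ψ) = Ψ` for the index relabelling of Schwartz functions. -/
theorem schwartzReindexCLM_schwartzReindexCLM_symm {ι ι' : Type} [Fintype ι] [Fintype ι'] (e : ι ≃ ι')
    (Ψ : 𝓢((ι' → mixedSpace (↥(maximalRealSubfield (L : Type)))), ℂ)) :
    schwartzReindexCLM (↥(maximalRealSubfield (L : Type))) e (schwartzReindexCLM (↥(maximalRealSubfield (L : Type))) e.symm Ψ) = Ψ := by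
  ext x
  simp only [schwartzReindexCLM_apply]
  rw [Function.comp_assoc, Equiv.self_comp_symm, Function.comp_id]

/-- **ROW 17's `harch` FROM ONE POLYNOMIAL IDENTITY.**  For any printed vector `φ` whose archimedean insertion polynomial is a multiple of the
relabelled wedge polynomial of carch-1's two line letters (`hpoly`), the (34) archimedean vector `archVec₃₄ … φ` is a multiple of the image
of the letter wedge under an explicit pure-tensor factorisation `(Tinf, Tf)` of `tau34` with spanning finite values — the `harch` slot of
`Real34CensusSideT.ofCensus` (#56) at `Z₂ := lineFam V S 0 hpos₂`, `Z₃ := lineFam V S 1 hpos₃`. -/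
theorem harch_of_insPoly
    (φ : (printPlaces (InfinitePlace (L : Type)) (HypCensus.kindOf (L : Type) (frameD V) (frameD_real V) (dW S) (dW_real S) ι₁ datum)
      (HypCensus.lamOf (L : Type) (frameD V) (frameD_real V) (dW S) (dW_real S) ι₁ datum)
      (HypCensus.lamOf_ne_zero (L : Type) (frameD V) (frameD_real V) (dW S) (dW_real S) ι₁ datum)
      (pinnedVacs (HypCensus.kindOf (L : Type) (frameD V) (frameD_real V) (dW S) (dW_real S) ι₁ datum) m₁ m₂)).F)
    (a'' : ℂ)
    (hpoly : HypCensus.insPoly (cmPlacesEquiv (L : Type))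
        (HypCensus.embOf (L : Type) (frameD V) (frameD_real V) (dW S) (dW_real S) ι₁ datum m₁ m₂) φ =
      a'' • rename (conjColPerm S) (wedgePoly V S hpos₂ hpos₃)) :
    ∃ (Tinf : 𝓢((Fin 3 → mixedSpace (↥(maximalRealSubfield (L : Type)))), ℂ) → 𝓢((Fin 3 → mixedSpace (↥(maximalRealSubfield (L : Type)))), ℂ) →
          𝓢((Fin 6 → mixedSpace (↥(maximalRealSubfield (L : Type)))), ℂ))
      (Tf : FinSB (↥(maximalRealSubfield (L : Type))) (Fin 3) →ₗ[ℂ] FinSB (↥(maximalRealSubfield (L : Type))) (Fin 3) →ₗ[ℂ]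
        FinSB (↥(maximalRealSubfield (L : Type))) (Fin 6)),
      (∀ (Φ₂ Φ₃ : 𝓢((Fin 3 → mixedSpace (↥(maximalRealSubfield (L : Type)))), ℂ)) (F₂ F₃ : FinSB (↥(maximalRealSubfield (L : Type))) (Fin 3)),
        tau34 V S (piSchwartzBruhatEquiv (↥(maximalRealSubfield (L : Type))) (Fin 3) (Φ₂ ⊗ₜ F₂))
            (piSchwartzBruhatEquiv (↥(maximalRealSubfield (L : Type))) (Fin 3) (Φ₃ ⊗ₜ F₃)) =
          piSchwartzBruhatEquiv (↥(maximalRealSubfield (L : Type))) (Fin 6) (Tinf Φ₂ Φ₃ ⊗ₜ Tf F₂ F₃)) ∧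
      Submodule.span ℂ (Set.range fun p : FinSB (↥(maximalRealSubfield (L : Type))) (Fin 3) × FinSB (↥(maximalRealSubfield (L : Type))) (Fin 3) =>
        Tf p.1 p.2) = ⊤ ∧
      ∃ a : ℂ, archVec₃₄ V S hGR η datum m₁ m₂ φ =
        a • (Tinf (lineFam V S 0 hpos₂ (LinearMap.proj 0)) (lineFam V S 1 hpos₃ (LinearMap.proj 1)) -
          Tinf (lineFam V S 0 hpos₂ (LinearMap.proj 1)) (lineFam V S 1 hpos₃ (LinearMap.proj 0))) := by
  -- (STRIP): the stripping `(A_∞, M_f)` of the see-saw lift `ω(r_F h₀)`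
  have hstrip := exists_cmConjLineTensorFin_tmul_eq_tmul V S
  obtain ⟨A, Mf, -, hAM, -⟩ := hstrip
  -- (T1)/(T2) with the archimedean factor exposed
  have hTT := exists_Tf_reindex_omega_tensorToSum_tmul (F := ↥(maximalRealSubfield (L : Type))) (finProdSumEquiv 3 1 1) finProdFinEquiv
    ArchSideTerm.e₁ ArchSideTerm.e₁
    (cmConjSeesawMp (L : Type) (frameD V) (frameD_real V) (frameD_ne V) (dW S) (dW_real S) (dW_ne S) (dW' S) (dW'_real S) (dW'_ne S)
      S.isoGL (isoGL_hg₀ S))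
    (A : 𝓢((Fin 3 × Fin (1 + 1) → mixedSpace (↥(maximalRealSubfield (L : Type)))), ℂ) →L[ℂ]
      𝓢((Fin 3 × Fin (1 + 1) → mixedSpace (↥(maximalRealSubfield (L : Type)))), ℂ)) Mf hAM
  obtain ⟨Tf, hT1, hT2⟩ := hTT
  -- (VT): `R_e ∘ A_∞ = c • ω_∞(1, k) ∘ (· ∘ J_S) ∘ R_e`
  have hVT := exists_reindex_archFactor_eq_smul_cmArchWeilRep_cmConjSeesawMp V S hGR A Mf hAM
  obtain ⟨c, hc⟩ := hVT
  refine ⟨fun Φ₂ Φ₃ => schwartzReindexCLM (↥(maximalRealSubfield (L : Type))) finProdFinEquiv (A (conjSlotRawBox (L := L) Φ₂ Φ₃)), Tf,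
    fun Φ₂ Φ₃ F₂ F₃ => ?_, hT2, ?_⟩
  · -- (T1): `tau34` unfolds (`rfl`) to the reindexed see-saw composite of § 1
    exact (cmConjLineTensorFin_eq_reindex_omega (L : Type) finProdFinEquiv ArchSideTerm.e₁ (frameD V) (frameD_real V) (frameD_ne V)
      (dW S) (dW_real S) (dW_ne S) (dW' S) (dW'_real S) (dW'_ne S) S.isoGL (isoGL_hg₀ S) _ _).trans (hT1 Φ₂ Φ₃ F₂ F₃)
  · -- `c ≠ 0`: `A_∞` is onto and the Gaussian of the pin's frame is not zero
    have hc0 : c ≠ 0 := by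
      intro h0
      have h1 := hc (A.symm (schwartzReindexCLM (↥(maximalRealSubfield (L : Type))) (finProdFinEquiv : Fin 3 × Fin 2 ≃ Fin (3 * 2)).symm
        (follandFock (slotFrame V S) 1)))
      rw [h0, zero_smul, ContinuousLinearEquiv.apply_symm_apply, schwartzReindexCLM_schwartzReindexCLM_symm] at h1
      exact follandFock_frame_one_ne_zero (slotFrame V S) h1
    -- the common vector `Y = ω_∞(1, k) (follandFock slotFrame (rename (conjColPerm S) wedgePoly))`
    -- RIGHT: the letter wedge through `Tinf`
    have hbox : ∀ (Φ₂ Φ₃ : 𝓢((Fin 3 → mixedSpace (↥(maximalRealSubfield (L : Type)))), ℂ)),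
        schwartzReindexCLM (↥(maximalRealSubfield (L : Type))) finProdFinEquiv (conjSlotRawBox (L := L) Φ₂ Φ₃) = slotArchBox Φ₂ Φ₃ :=
      fun _ _ => rfl
    have hR : schwartzReindexCLM (↥(maximalRealSubfield (L : Type))) finProdFinEquiv
          (A (conjSlotRawBox (L := L) (lineFam V S 0 hpos₂ (LinearMap.proj 0)) (lineFam V S 1 hpos₃ (LinearMap.proj 1)))) -
        schwartzReindexCLM (↥(maximalRealSubfield (L : Type))) finProdFinEquiv
          (A (conjSlotRawBox (L := L) (lineFam V S 0 hpos₂ (LinearMap.proj 1)) (lineFam V S 1 hpos₃ (LinearMap.proj 0)))) =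
        c • cmArchWeilRep (L : Type) finProdFinEquiv (frameD V) (frameD_real V) (frameD_ne V) (dW S) (dW_real S) (dW_ne S) hGR
          (1, conjTransportK S) (follandFock (slotFrame V S) (rename (conjColPerm S) (wedgePoly V S hpos₂ hpos₃))) := by
      rw [← map_sub, ← map_sub, hc, map_sub, hbox, hbox, slotArchBox_lineFam_wedge, compCLM_conjFrameTransport_follandFock_planeFrame_dW']
    -- LEFT: `archVec₃₄ φ` through binder-2's twist = theta-3's transport element (`isoTwistPin_eq_conjTransportK`), and `hpoly`
    have h2 : follandFock (slotFrame V S) (HypCensus.insPoly (cmPlacesEquiv (L : Type))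
          (HypCensus.embOf (L : Type) (frameD V) (frameD_real V) (dW S) (dW_real S) ι₁ datum m₁ m₂) φ) =
        a'' • follandFock (slotFrame V S) (rename (conjColPerm S) (wedgePoly V S hpos₂ hpos₃)) := by
      rw [hpoly, follandFock_smul]
    have h3 : cmArchWeilRep (L : Type) finProdFinEquiv (frameD V) (frameD_real V) (frameD_ne V) (dW S) (dW_real S) (dW_ne S) hGR
          (1, conjTransportK S) (follandFock (slotFrame V S) (HypCensus.insPoly (cmPlacesEquiv (L : Type))
            (HypCensus.embOf (L : Type) (frameD V) (frameD_real V) (dW S) (dW_real S) ι₁ datum m₁ m₂) φ)) =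
        a'' • cmArchWeilRep (L : Type) finProdFinEquiv (frameD V) (frameD_real V) (frameD_ne V) (dW S) (dW_real S) (dW_ne S) hGR
          (1, conjTransportK S) (follandFock (slotFrame V S) (rename (conjColPerm S) (wedgePoly V S hpos₂ hpos₃))) :=
      (congrArg _ h2).trans (LinearMap.map_smul _ _ _)
    -- `archVec₃₄ φ` read at ANY twist element equal to binder-2's (generalise, then substitute theta-3's)
    have gen : ∀ k : ↥(UnitaryGroup.arch (↥(maximalRealSubfield (L : Type))) (L : Type) (IsCMField.complexConj (L : Type)) 2 (Matrix.diagonal (dW S))),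
        isoTwistPin S = k →
          archVec₃₄ V S hGR η datum m₁ m₂ φ =
            (((η (wPair V S k)) : ℂˣ) : ℂ) •
              cmArchWeilRep (L : Type) finProdFinEquiv (frameD V) (frameD_real V) (frameD_ne V) (dW S) (dW_real S) (dW_ne S) hGR (1, k)
                (follandFock (slotFrame V S) (HypCensus.insPoly (cmPlacesEquiv (L : Type))
                  (HypCensus.embOf (L : Type) (frameD V) (frameD_real V) (dW S) (dW_real S) ι₁ datum m₁ m₂) φ)) := by
      rintro _ rfl
      rfl
    have hL : archVec₃₄ V S hGR η datum m₁ m₂ φ =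
        ((((η (wPair V S (conjTransportK S))) : ℂˣ) : ℂ) * a'') •
          cmArchWeilRep (L : Type) finProdFinEquiv (frameD V) (frameD_real V) (frameD_ne V) (dW S) (dW_real S) (dW_ne S) hGR
            (1, conjTransportK S) (follandFock (slotFrame V S) (rename (conjColPerm S) (wedgePoly V S hpos₂ hpos₃))) :=
      (gen _ (isoTwistPin_eq_conjTransportK S)).trans
        ((congrArg (fun Z => (((η (wPair V S (conjTransportK S))) : ℂˣ) : ℂ) • Z) h3).trans (smul_smul _ _ _))
    refine ⟨(((η (wPair V S (conjTransportK S))) : ℂˣ) : ℂ) * a'' * c⁻¹, hL.trans ?_⟩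
    refine Eq.trans ?_ (congrArg (fun Z => ((((η (wPair V S (conjTransportK S))) : ℂˣ) : ℂ) * a'' * c⁻¹) • Z) hR).symm
    rw [smul_smul, inv_mul_cancel_right₀ hc0]

end Harch

end HodgeCM.Model

end
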